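import Summits.CriticalPhenomena.PercolationContinuityZ3.Theorems.PercNearOneGluingNoHeavyLowerTailThreePointTransplantOrbits
import HarnessLib

/-!
# The PRODUCT FORM of the halving lemma: Cauchy–Schwarz transfer from class counts, and its consequences
# (Sahi programme, prover prim-sahi-p2 gen 53)

Support file (`--supports stmt-CriticalPhenomena-4575`, helper), continuing `…ThreePointTransplantOrbits` (gen 52: the ORBIT PRINCIPLE
`#(O ∩ A×B) ≤ c·#(O ∩ T×Ω)` per class `⟹ μ(A)μ(B) ≤ c·μ(T)`).  Standard axioms, no sorries, no named facts, no definitions.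
Memo `run/shared/lean/prim/prim-sahi/FROM-prim-sahi-p2-gen53-PRODUCT-FORM.md`, `prim-sahi-p2/PROOF-E3.md` §63.

SETTING.  `μ = prodBernoulli w` on a finite vertex type, terminals `s, a, c`; cells `T = μ(sac)`, `p₁ = μ(sa|c)`, `p₂ = μ(ac|s)`,
`p₃ = μ(sc|a)`, `p₀ = μ(s|a|c)`; `U = {a↔s} ∪ {a↔c}`, `D = {s↮c}`, `X = U ∩ D = sa|c ⊔ ac|s`, so `μ(X) = p₁ + p₂` and
`μ(U)μ(D) − μ(X) = T·p₀ − (p₁+p₂)·p₃` (the 'halving gap').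

WHAT IS PROVED (all graphs, all weights; everything conditional is conditional on an explicit hypothesis in the binder).
* **`sum_sub_le_sqrt_of_classCount`** — the abstract CAUCHY–SCHWARZ CLASS PRINCIPLE: for a nonnegative weight constant on the classes of a
  labelling and finite sets `A, T, P, Q`, if in every class `k`, `#(A∩k) − #(T∩k) ≤ √(#(P∩k)·#(Q∩k))`, then
  `Σ_A wt − Σ_T wt ≤ √(Σ_P wt · Σ_Q wt)`. [folklore: Cauchy–Schwarz `Finset.sum_sq_le_sum_mul_sum_of_sq_le_mul`]
* **`real_mul_real_sub_le_sqrt_of_orbitCounts`** — two-copy form: for a weight-preserving finite family of maps of `Ω × Ω` and the classes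
  `O` of the equivalence it generates, per-class `#(O∩A×B) − #(O∩T×Ω) ≤ √(#(O∩P×Ω)·#(O∩Q×Ω))` gives `μ(A)μ(B) − μ(T) ≤ √(μ(P)μ(Q))`.
* **`halving_sqrt_of_orbitCounts`** [this work] — the specialisation: per-class `#(O∩U×D) − #(O∩X×Ω) ≤ √(#(O∩P1×Ω)·#(O∩P2×Ω))`
  (`P1 = sa|c`, `P2 = ac|s`) gives the PRODUCT FORM  `μ(U)·μ(D) − μ(U∩D) ≤ √(μ(sa|c)·μ(ac|s))`.
* Cell arithmetic of the product form [this work] (AM–GM `√(p₁p₂) ≤ (p₁+p₂)/2` inlined; cf. `Literature.Analysis.FluidPDE.sqrt_mul_le_add_half`): `sharp_halving_of_productForm` (product form `⟹ 2μ(U)μ(D) ≤ 3μ(U∩D)`, gen 44's sharp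
  constant, by AM–GM), `core_of_productForm` (`T·p₀ ≤ (p₁+p₂)p₃ + √(p₁p₂)`), `conj101_of_productForm` (`T·p₀ − p₃·p₂ ≤ p₁·p₃ + √(p₁p₂)`, so
  `p₁ < δ ⟹ T·p₀ − p₃p₂ < δ + √δ`: the `ε`–`δ` statement of Gladkov's Conjecture 10.1 = GZ24 Conj. 6.3 with `δ(ε) = ε²/4`, at every graph where
  the product form holds), `dichotomy_of_productForm` (Gladkov's Thm 1.3 with `δ = ε²/3`), and the measure-level readings
  `productForm_cells`, `sharp_halving_of_productForm_real`, `conj101_of_productForm_real`.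
CONJECTURE (P) (NOT asserted; this gen's census, kit j338867 / j338868, engine `pcount.c`: ZERO exceptions): in the fibre language of gen 44–52
(type-1 minor `H`, states `T ⊆ E(H)`, copy 2 = complement, `♭T = T △ Ē(C_a T)`), for EVERY finite multigraph and EVERY class `O` of the
group generated by the three a-based transplants, `bad_O² ≤ P1_O · P2_O` where `bad = {T ∈ s|a|c : s ↔ c in ♭T}` (`#bad_O = #(O∩U×D) − #(O∩X×Ω)`),
`P1_O = #{T ∈ O : T ∈ sa|c}`, `P2_O = #{T ∈ O : T ∈ ac|s}`; by `halving_sqrt_of_orbitCounts` this gives the product form on every weighted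
graph, hence the sharp halving inequality, the quadratic-rate dichotomy and Conjecture 10.1 with `δ = ε²/4`.
[cite: Gladkov2024, Thm. 1.3 (p. 2, §7.2) and Conjecture 10.1 (p. 18), arXiv:2408.08457; GladkovZimin2024, Conj. 6.3]; [folklore] (Cauchy–Schwarz).
-/

noncomputable section

open Classical

namespace Summit.CriticalPhenomena.PercolationContinuityZ3.Theorems

namespace ProductForm

open MeasureTheory Finset
open Literature.Probability.Percolation Literature.Probability.LatticeModels
open Literature.Probability.Percolation.BHK2006 (weight weight_nonneg)
open Literature.Probability.Percolation.DecisionTree (ind ind_of_mem ind_of_not_mem ind_nonneg)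
open TransplantDictionary (sum_weight_eq_one real_mul_real_eq_sum_wt2)
open TransplantOrbits (eqvGen_idem wt2_eq_of_orbit sum_wt2_ind_fst)

/-! ### 1. The abstract Cauchy–Schwarz class principle -/

/-- **CAUCHY–SCHWARZ CLASS PRINCIPLE.**  Let a nonnegative weight be constant on the classes of a labelling `cls`.  If in every class
`k`, `#(A ∩ k) − #(T ∩ k) ≤ √(#(P ∩ k) · #(Q ∩ k))`, then `Σ_A wt − Σ_T wt ≤ √(Σ_P wt · Σ_Q wt)`. [folklore] -/
theorem sum_sub_le_sqrt_of_classCount {α κ : Type*} (wt : α → ℝ) (hwt : ∀ x, 0 ≤ wt x) (cls : α → κ)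
    (hcls : ∀ x y, cls x = cls y → wt x = wt y) (A T P Q : Finset α)
    (hcount : ∀ k, (((A.filter fun x => cls x = k).card : ℕ) : ℝ) - ((T.filter fun x => cls x = k).card : ℕ) ≤
      Real.sqrt ((((P.filter fun x => cls x = k).card : ℕ) : ℝ) * ((Q.filter fun x => cls x = k).card : ℕ))) :
    ∑ x ∈ A, wt x - ∑ x ∈ T, wt x ≤ Real.sqrt ((∑ x ∈ P, wt x) * (∑ x ∈ Q, wt x)) := by
  classical
  set U : Finset α := A ∪ T ∪ P ∪ Q with hU
  set L : Finset κ := U.image cls with hL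
  -- a class weight, read off any element of the class inside `U`
  set w : κ → ℝ := fun k => if h : ∃ x ∈ U, cls x = k then wt h.choose else 0 with hw
  have hw0 : ∀ k, 0 ≤ w k := by
    intro k
    by_cases h : ∃ x ∈ U, cls x = k
    · simp only [hw, dif_pos h]; exact hwt _
    · simp only [hw, dif_neg h]; exact le_rfl
  have hweq : ∀ k, ∀ x ∈ U, cls x = k → wt x = w k := by
    intro k x hx hxk
    have h : ∃ x ∈ U, cls x = k := ⟨x, hx, hxk⟩
    simp only [hw, dif_pos h]
    exact hcls x h.choose (hxk.trans h.choose_spec.2.symm)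
  have fib : ∀ S : Finset α, S ⊆ U →
      ∑ x ∈ S, wt x = ∑ k ∈ L, (((S.filter fun x => cls x = k).card : ℕ) : ℝ) * w k := by
    intro S hS
    have h1 : ∑ x ∈ S, wt x = ∑ k ∈ L, ∑ x ∈ S.filter (fun x => cls x = k), wt x :=
      (Finset.sum_fiberwise_of_maps_to (fun x hx => Finset.mem_image_of_mem cls (hS hx)) _).symm
    rw [h1]
    refine Finset.sum_congr rfl fun k _ => ?_
    rw [Finset.sum_congr rfl fun x hx => hweq k x (hS (Finset.mem_filter.1 hx).1) (Finset.mem_filter.1 hx).2,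
      Finset.sum_const, nsmul_eq_mul]
  have hA : A ⊆ U := by
    intro x hx; simp only [hU, Finset.mem_union]; exact Or.inl (Or.inl (Or.inl hx))
  have hT : T ⊆ U := by
    intro x hx; simp only [hU, Finset.mem_union]; exact Or.inl (Or.inl (Or.inr hx))
  have hP : P ⊆ U := by
    intro x hx; simp only [hU, Finset.mem_union]; exact Or.inl (Or.inr hx)
  have hQ : Q ⊆ U := by
    intro x hx; simp only [hU, Finset.mem_union]; exact Or.inr hx
  rw [fib A hA, fib T hT, fib P hP, fib Q hQ, ← Finset.sum_sub_distrib]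
  -- abbreviations for the class counts
  set fa : κ → ℝ := fun k => (((A.filter fun x => cls x = k).card : ℕ) : ℝ)
  set ft : κ → ℝ := fun k => (((T.filter fun x => cls x = k).card : ℕ) : ℝ)
  set fp : κ → ℝ := fun k => (((P.filter fun x => cls x = k).card : ℕ) : ℝ)
  set fq : κ → ℝ := fun k => (((Q.filter fun x => cls x = k).card : ℕ) : ℝ)
  have hp0 : ∀ k, 0 ≤ fp k := fun k => Nat.cast_nonneg _
  have hq0 : ∀ k, 0 ≤ fq k := fun k => Nat.cast_nonneg _
  -- step 1: classwise
  have step1 : ∑ k ∈ L, (fa k * w k - ft k * w k) ≤ ∑ k ∈ L, w k * Real.sqrt (fp k * fq k) := by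
    refine Finset.sum_le_sum fun k _ => ?_
    rw [← sub_mul, mul_comm]
    exact mul_le_mul_of_nonneg_left (hcount k) (hw0 k)
  -- step 2: Cauchy–Schwarz over the classes
  have step2 : (∑ k ∈ L, w k * Real.sqrt (fp k * fq k)) ^ 2 ≤ (∑ k ∈ L, fp k * w k) * ∑ k ∈ L, fq k * w k := by
    refine Finset.sum_sq_le_sum_mul_sum_of_sq_le_mul L (fun k _ => mul_nonneg (hp0 k) (hw0 k))
      (fun k _ => mul_nonneg (hq0 k) (hw0 k)) fun k _ => ?_
    rw [mul_pow, Real.sq_sqrt (mul_nonneg (hp0 k) (hq0 k))]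
    nlinarith [hw0 k, hp0 k, hq0 k]
  have hS : 0 ≤ ∑ k ∈ L, w k * Real.sqrt (fp k * fq k) :=
    Finset.sum_nonneg fun k _ => mul_nonneg (hw0 k) (Real.sqrt_nonneg _)
  calc ∑ k ∈ L, (fa k * w k - ft k * w k)
      ≤ ∑ k ∈ L, w k * Real.sqrt (fp k * fq k) := step1
    _ = Real.sqrt ((∑ k ∈ L, w k * Real.sqrt (fp k * fq k)) ^ 2) := (Real.sqrt_sq hS).symm
    _ ≤ Real.sqrt ((∑ k ∈ L, fp k * w k) * ∑ k ∈ L, fq k * w k) := Real.sqrt_le_sqrt step2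

/-- Convenience: how a per-class PRODUCT COUNT `(a − t)² ≤ p·q` (or `a ≤ t`) yields the hypothesis of the principle. [folklore] -/
theorem sub_le_sqrt_of_sq_le {a t p q : ℝ} (h : a ≤ t ∨ (a - t) ^ 2 ≤ p * q) :
    a - t ≤ Real.sqrt (p * q) := by
  rcases h with h | h
  · exact (sub_nonpos.2 h).trans (Real.sqrt_nonneg _)
  · calc a - t ≤ |a - t| := le_abs_self _
      _ = Real.sqrt ((a - t) ^ 2) := (Real.sqrt_sq_eq_abs _).symm
      _ ≤ Real.sqrt (p * q) := Real.sqrt_le_sqrt h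

/-! ### 2. Two-copy percolation: the product form from orbit counts -/

variable {V : Type*} [Fintype V]

/-- **Two-copy PRODUCT inequalities from orbit counts.**  Let the finite family `f i` preserve the two-copy weight and let `~` be the
equivalence relation it generates on `Ω × Ω`.  If for every class `O`, `#(O ∩ (A × B)) − #(O ∩ (T × Ω)) ≤ √(#(O ∩ (P × Ω)) · #(O ∩ (Q × Ω)))`,
then `μ(A)·μ(B) − μ(T) ≤ √(μ(P)·μ(Q))`. [this work] -/
theorem real_mul_real_sub_le_sqrt_of_orbitCounts (w : Sym2 V → unitInterval) (A B T P Q : Set (BondConfig V)) {ι : Type*}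
    (W : Finset ι) (f : ι → BondConfig V × BondConfig V → BondConfig V × BondConfig V)
    (hwf : ∀ i ∈ W, ∀ θ, weight (fun e => (w e : ℝ)) (f i θ).1 * weight (fun e => (w e : ℝ)) (f i θ).2 =
        weight (fun e => (w e : ℝ)) θ.1 * weight (fun e => (w e : ℝ)) θ.2)
    (hcount : ∀ O : Quot (Relation.EqvGen (fun x y : BondConfig V × BondConfig V => ∃ i ∈ W, y = f i x)),
      ((((Finset.univ.filter fun θ : BondConfig V × BondConfig V => θ.1 ∈ A ∧ θ.2 ∈ B).filter
          fun θ => Quot.mk _ θ = O).card : ℕ) : ℝ) -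
        (((Finset.univ.filter fun θ : BondConfig V × BondConfig V => θ.1 ∈ T).filter fun θ => Quot.mk _ θ = O).card : ℕ) ≤
        Real.sqrt ((((Finset.univ.filter fun θ : BondConfig V × BondConfig V => θ.1 ∈ P).filter
              fun θ => Quot.mk _ θ = O).card : ℕ) *
          (((Finset.univ.filter fun θ : BondConfig V × BondConfig V => θ.1 ∈ Q).filter fun θ => Quot.mk _ θ = O).card : ℕ))) :
    (prodBernoulli w).real A * (prodBernoulli w).real B - (prodBernoulli w).real T ≤
      Real.sqrt ((prodBernoulli w).real P * (prodBernoulli w).real Q) := by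
  classical
  set wt : BondConfig V × BondConfig V → ℝ := fun θ => weight (fun e => (w e : ℝ)) θ.1 * weight (fun e => (w e : ℝ)) θ.2 with hwt
  have hw0 : ∀ e, 0 ≤ ((w e : unitInterval) : ℝ) := fun e => (w e).2.1
  have hw1 : ∀ e, ((w e : unitInterval) : ℝ) ≤ 1 := fun e => (w e).2.2
  have hwt0 : ∀ θ, 0 ≤ wt θ := fun θ => mul_nonneg (weight_nonneg hw0 hw1 _) (weight_nonneg hw0 hw1 _)
  set r := Relation.EqvGen (fun x y : BondConfig V × BondConfig V => ∃ i ∈ W, y = f i x) with hr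
  set cls : BondConfig V × BondConfig V → Quot r := fun θ => Quot.mk _ θ with hcls_def
  have hcls : ∀ x y, cls x = cls y → wt x = wt y := by
    intro x y hxy
    have hxy' : Relation.EqvGen (fun x y : BondConfig V × BondConfig V => ∃ i ∈ W, y = f i x) x y :=
      eqvGen_idem (Quot.eqvGen_exact hxy)
    exact wt2_eq_of_orbit (fun e => (w e : ℝ)) W f hwf hxy'
  set SA : Finset (BondConfig V × BondConfig V) := Finset.univ.filter fun θ => θ.1 ∈ A ∧ θ.2 ∈ B with hSA
  set ST : Finset (BondConfig V × BondConfig V) := Finset.univ.filter fun θ => θ.1 ∈ T with hST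
  set SP : Finset (BondConfig V × BondConfig V) := Finset.univ.filter fun θ => θ.1 ∈ P with hSP
  set SQ : Finset (BondConfig V × BondConfig V) := Finset.univ.filter fun θ => θ.1 ∈ Q with hSQ
  have hmain := sum_sub_le_sqrt_of_classCount wt hwt0 cls hcls SA ST SP SQ hcount
  have hL : (prodBernoulli w).real A * (prodBernoulli w).real B = ∑ θ ∈ SA, wt θ := by
    rw [real_mul_real_eq_sum_wt2, hSA, Finset.sum_filter]
    refine Finset.sum_congr rfl fun θ _ => ?_
    by_cases h1 : θ.1 ∈ A <;> by_cases h2 : θ.2 ∈ B <;> simp [ind_of_mem, ind_of_not_mem, h1, h2, hwt]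
  have hfst : ∀ (R : Set (BondConfig V)),
      ∑ θ ∈ (Finset.univ.filter fun θ : BondConfig V × BondConfig V => θ.1 ∈ R), wt θ = (prodBernoulli w).real R := by
    intro R
    rw [← sum_wt2_ind_fst w R, Finset.sum_filter]
    refine Finset.sum_congr rfl fun θ _ => ?_
    by_cases h1 : θ.1 ∈ R <;> simp [ind_of_mem, ind_of_not_mem, h1, hwt]
  rw [hL, ← hfst T, ← hfst P, ← hfst Q]
  exact hmain

/-- **THE PRODUCT FORM OF THE HALVING LEMMA FROM ORBIT COUNTS.**  If a weight-preserving finite family of maps of `Ω × Ω` (e.g. the transplant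
recipes) has, in every class `O` of the equivalence relation it generates,
`#(O ∩ (U × D)) − #(O ∩ (X × Ω)) ≤ √(#(O ∩ (P1 × Ω)) · #(O ∩ (P2 × Ω)))` with `U = {a↔s} ∪ {a↔c}`, `D = {s↮c}`, `X = U ∩ D`,
`P1 = {a↔s, a↮c}`, `P2 = {a↔c, a↮s}`, then  `μ(U)·μ(D) − μ(U ∩ D) ≤ √(μ(P1)·μ(P2))`. [this work] -/
theorem halving_sqrt_of_orbitCounts (w : Sym2 V → unitInterval) (s a c : V) {ι : Type*} (W : Finset ι)
    (f : ι → BondConfig V × BondConfig V → BondConfig V × BondConfig V)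
    (hwf : ∀ i ∈ W, ∀ θ, weight (fun e => (w e : ℝ)) (f i θ).1 * weight (fun e => (w e : ℝ)) (f i θ).2 =
        weight (fun e => (w e : ℝ)) θ.1 * weight (fun e => (w e : ℝ)) θ.2)
    (hcount : ∀ O : Quot (Relation.EqvGen (fun x y : BondConfig V × BondConfig V => ∃ i ∈ W, y = f i x)),
      ((((Finset.univ.filter fun θ : BondConfig V × BondConfig V =>
            θ.1 ∈ (openConn s a ∪ openConn c a : Set (BondConfig V)) ∧ θ.2 ∈ ((openConn s c)ᶜ : Set (BondConfig V))).filter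
          fun θ => Quot.mk _ θ = O).card : ℕ) : ℝ) -
        (((Finset.univ.filter fun θ : BondConfig V × BondConfig V =>
            θ.1 ∈ ((openConn s a ∪ openConn c a) ∩ (openConn s c)ᶜ : Set (BondConfig V))).filter fun θ => Quot.mk _ θ = O).card : ℕ) ≤
        Real.sqrt ((((Finset.univ.filter fun θ : BondConfig V × BondConfig V =>
              θ.1 ∈ (openConn s a ∩ (openConn c a)ᶜ : Set (BondConfig V))).filter fun θ => Quot.mk _ θ = O).card : ℕ) *
          (((Finset.univ.filter fun θ : BondConfig V × BondConfig V =>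
              θ.1 ∈ (openConn c a ∩ (openConn s a)ᶜ : Set (BondConfig V))).filter fun θ => Quot.mk _ θ = O).card : ℕ))) :
    (prodBernoulli w).real (openConn s a ∪ openConn c a : Set (BondConfig V)) *
        (prodBernoulli w).real ((openConn s c)ᶜ : Set (BondConfig V)) -
        (prodBernoulli w).real ((openConn s a ∪ openConn c a) ∩ (openConn s c)ᶜ : Set (BondConfig V)) ≤
      Real.sqrt ((prodBernoulli w).real (openConn s a ∩ (openConn c a)ᶜ : Set (BondConfig V)) *
        (prodBernoulli w).real (openConn c a ∩ (openConn s a)ᶜ : Set (BondConfig V))) := by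
  refine real_mul_real_sub_le_sqrt_of_orbitCounts w _ _ _ _ _ W f hwf fun O => ?_
  convert hcount O

/-! ### 3. Cell arithmetic of the product form -/

omit [Fintype V] in
/-- **Product form ⟹ the SHARP halving inequality** `2·μ(U)μ(D) ≤ 3·μ(U∩D)` (gen 44's constant `3/2`), since `μ(U∩D) = p₁ + p₂ ≥ 2√(p₁p₂)`.
[this work] -/
theorem sharp_halving_of_productForm {U D X p₁ p₂ : ℝ} (h1 : 0 ≤ p₁) (h2 : 0 ≤ p₂) (hX : X = p₁ + p₂)
    (hP : U * D - X ≤ Real.sqrt (p₁ * p₂)) : 2 * (U * D) ≤ 3 * X := by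
  have hamgm : Real.sqrt (p₁ * p₂) ≤ (p₁ + p₂) / 2 := by
    have h : p₁ * p₂ ≤ ((p₁ + p₂) / 2) ^ 2 := by nlinarith [sq_nonneg (p₁ - p₂)]
    calc Real.sqrt (p₁ * p₂) ≤ Real.sqrt (((p₁ + p₂) / 2) ^ 2) := Real.sqrt_le_sqrt h
      _ = (p₁ + p₂) / 2 := Real.sqrt_sq (by linarith)
  linarith

omit [Fintype V] in
/-- **Product form in the cells**: with `T + p₁ + p₂ + p₃ + p₀ = 1`, `(T+p₁+p₂)(p₀+p₁+p₂) − (p₁+p₂) ≤ √(p₁p₂)` reads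
`T·p₀ ≤ (p₁+p₂)·p₃ + √(p₁p₂)`. [this work] -/
theorem core_of_productForm {T p₁ p₂ p₃ p₀ : ℝ} (hsum : T + p₁ + p₂ + p₃ + p₀ = 1)
    (hP : (T + p₁ + p₂) * (p₀ + p₁ + p₂) - (p₁ + p₂) ≤ Real.sqrt (p₁ * p₂)) :
    T * p₀ ≤ (p₁ + p₂) * p₃ + Real.sqrt (p₁ * p₂) := by
  have key : (T + p₁ + p₂) * (p₀ + p₁ + p₂) - (p₁ + p₂) = T * p₀ - (p₁ + p₂) * p₃ := by
    have : p₀ = 1 - T - p₁ - p₂ - p₃ := by linarith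
    subst this; ring
  linarith [key]

omit [Fintype V] in
/-- **Product form ⟹ Gladkov's Conjecture 10.1 (= GZ24 Conj. 6.3) at this graph, with an explicit rate.**  In the printed notation
(apex `b` = our `a`; `P(abc) = T`, `P(a|b|c) = p₀`, `P(ab|c) = p₁`, `P(a|bc) = p₂`, `P(ac|b) = p₃`):
`P(abc)·P(a|b|c) − P(ac|b)·P(a|bc) ≤ P(ab|c)·P(ac|b) + √(P(ab|c)·P(a|bc)) ≤ P(ab|c) + √P(ab|c)`, so `P(ab|c) < δ` forces the printed
difference below `δ + √δ` (`≤ ε` once `δ ≤ ε²/4`, `ε ≤ 1`).  Conditional on the product form at this graph; nothing here asserts it.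
[cite: Gladkov2024, Conjecture 10.1 (p. 18), arXiv:2408.08457] [this work] -/
theorem conj101_of_productForm {T p₁ p₂ p₃ p₀ : ℝ} (h1 : 0 ≤ p₁) (hp2 : p₂ ≤ 1) (hp3 : p₃ ≤ 1)
    (hsum : T + p₁ + p₂ + p₃ + p₀ = 1)
    (hP : (T + p₁ + p₂) * (p₀ + p₁ + p₂) - (p₁ + p₂) ≤ Real.sqrt (p₁ * p₂)) :
    T * p₀ - p₃ * p₂ ≤ p₁ * p₃ + Real.sqrt (p₁ * p₂) ∧ T * p₀ - p₃ * p₂ ≤ p₁ + Real.sqrt p₁ := by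
  have hc := core_of_productForm hsum hP
  refine ⟨by linarith, ?_⟩
  have hs : Real.sqrt (p₁ * p₂) ≤ Real.sqrt p₁ := Real.sqrt_le_sqrt (by nlinarith)
  have h13 : p₁ * p₃ ≤ p₁ := by nlinarith
  linarith

omit [Fintype V] in
/-- **ε–δ reading of `conj101_of_productForm`**: `p₁ < δ ≤ 1 ⟹ T·p₀ − p₃·p₂ < δ + √δ`. [cite: Gladkov2024, Conjecture 10.1] [this work] -/
theorem conj101_rate_of_productForm {T p₁ p₂ p₃ p₀ δ : ℝ} (h1 : 0 ≤ p₁) (hp2 : p₂ ≤ 1) (hp3 : p₃ ≤ 1)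
    (hsum : T + p₁ + p₂ + p₃ + p₀ = 1)
    (hP : (T + p₁ + p₂) * (p₀ + p₁ + p₂) - (p₁ + p₂) ≤ Real.sqrt (p₁ * p₂)) (hδ : p₁ < δ) :
    T * p₀ - p₃ * p₂ < δ + Real.sqrt δ := by
  have h := (conj101_of_productForm h1 hp2 hp3 hsum hP).2
  have hs : Real.sqrt p₁ ≤ Real.sqrt δ := Real.sqrt_le_sqrt hδ.le
  linarith

omit [Fintype V] in
/-- **Product form ⟹ Gladkov's three-cluster dichotomy with quadratic rate**: `p₁, p₂ < ε²/3 ⟹ T < ε ∨ p₀ < ε` (print: `δ < ε³/4`).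
[cite: Gladkov2024, Thm. 1.3] [this work] -/
theorem dichotomy_of_productForm {T p₁ p₂ p₃ p₀ ε : ℝ} (hT : 0 ≤ T) (h1 : 0 ≤ p₁) (h2 : 0 ≤ p₂) (hp3 : p₃ ≤ 1)
    (hsum : T + p₁ + p₂ + p₃ + p₀ = 1) (hε : 0 < ε)
    (hP : (T + p₁ + p₂) * (p₀ + p₁ + p₂) - (p₁ + p₂) ≤ Real.sqrt (p₁ * p₂))
    (hp1 : p₁ < ε ^ 2 / 3) (hp2 : p₂ < ε ^ 2 / 3) : T < ε ∨ p₀ < ε := by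
  have hc := core_of_productForm hsum hP
  have hamgm : Real.sqrt (p₁ * p₂) ≤ (p₁ + p₂) / 2 := by
    have h : p₁ * p₂ ≤ ((p₁ + p₂) / 2) ^ 2 := by nlinarith [sq_nonneg (p₁ - p₂)]
    calc Real.sqrt (p₁ * p₂) ≤ Real.sqrt (((p₁ + p₂) / 2) ^ 2) := Real.sqrt_le_sqrt h
      _ = (p₁ + p₂) / 2 := Real.sqrt_sq (by linarith)
  by_contra hcon
  rw [not_or, not_lt, not_lt] at hcon
  obtain ⟨hTe, h0e⟩ := hcon
  have hε2 : ε ^ 2 ≤ T * p₀ := by nlinarith [mul_le_mul hTe h0e hε.le hT]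
  have hX : (p₁ + p₂) * p₃ ≤ p₁ + p₂ := by nlinarith
  nlinarith [hamgm]

/-! ### 4. Measure-level readings -/

/-- **The product form in the five cells.**  If `μ(U)μ(D) − μ(U∩D) ≤ √(μ(sa|c)μ(ac|s))` at `(w; s, a, c)`, then
`μ(sac)·μ(s|a|c) ≤ (μ(sa|c)+μ(ac|s))·μ(sc|a) + √(μ(sa|c)·μ(ac|s))` and `μ(sac)·μ(s|a|c) − μ(sc|a)·μ(ac|s) ≤ μ(sa|c) + √μ(sa|c)`
(Gladkov's Conjecture 10.1 quantity, apex relabelled).  Conditional on the hypothesis; nothing here asserts it. [this work] -/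
theorem productForm_cells (w : Sym2 V → unitInterval) (s a c : V)
    (hP : (prodBernoulli w).real (openConn s a ∪ openConn c a) * (prodBernoulli w).real ((openConn s c)ᶜ) -
        (prodBernoulli w).real ((openConn s a ∪ openConn c a) ∩ (openConn s c)ᶜ) ≤
      Real.sqrt ((prodBernoulli w).real (openConn s a ∩ (openConn s c)ᶜ) * (prodBernoulli w).real (openConn c a ∩ (openConn c s)ᶜ))) :
    (prodBernoulli w).real (openConn s a ∩ openConn s c) *
        (prodBernoulli w).real ((openConn s a)ᶜ ∩ (openConn s c)ᶜ ∩ (openConn c a)ᶜ) ≤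
      ((prodBernoulli w).real (openConn s a ∩ (openConn s c)ᶜ) + (prodBernoulli w).real (openConn c a ∩ (openConn c s)ᶜ)) *
          (prodBernoulli w).real (openConn s c ∩ (openConn s a)ᶜ) +
        Real.sqrt ((prodBernoulli w).real (openConn s a ∩ (openConn s c)ᶜ) * (prodBernoulli w).real (openConn c a ∩ (openConn c s)ᶜ)) ∧
    (prodBernoulli w).real (openConn s a ∩ openConn s c) *
        (prodBernoulli w).real ((openConn s a)ᶜ ∩ (openConn s c)ᶜ ∩ (openConn c a)ᶜ) -
        (prodBernoulli w).real (openConn s c ∩ (openConn s a)ᶜ) * (prodBernoulli w).real (openConn c a ∩ (openConn c s)ᶜ) ≤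
      (prodBernoulli w).real (openConn s a ∩ (openConn s c)ᶜ) + Real.sqrt ((prodBernoulli w).real (openConn s a ∩ (openConn s c)ᶜ)) := by
  set μ := prodBernoulli w with hμ
  have hX : μ.real ((openConn s a ∪ openConn c a) ∩ (openConn s c)ᶜ) =
      μ.real (openConn s a ∩ (openConn s c)ᶜ) + μ.real (openConn c a ∩ (openConn c s)ᶜ) := by
    rw [HalvingTransplant.inter_D_eq_union, measureReal_union (HalvingTransplant.disjoint_pairSep s a c) MeasurableSet.of_discrete]
  have hU : μ.real (openConn s a ∪ openConn c a) =
      μ.real ((openConn s a ∪ openConn c a) ∩ (openConn s c)ᶜ) + μ.real (openConn s a ∩ openConn s c) := by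
    rw [← HalvingTransplant.inter_Dc_eq_J s a c,
      ← measureReal_inter_add_sdiff₀ (μ := μ) (s := openConn s a ∪ openConn c a) (t := (openConn s c)ᶜ)
      (MeasurableSet.of_discrete).nullMeasurableSet]
    congr 2
    ext ω; simp only [Set.mem_sdiff, Set.mem_compl_iff, not_not, Set.mem_inter_iff]
  have hD : μ.real ((openConn s c)ᶜ) =
      μ.real ((openConn s a ∪ openConn c a) ∩ (openConn s c)ᶜ) + μ.real ((openConn s a)ᶜ ∩ (openConn s c)ᶜ ∩ (openConn c a)ᶜ) := by
    rw [← HalvingTransplant.D_diff_U_eq_Z0 s a c, Set.inter_comm (openConn s a ∪ openConn c a),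
      ← measureReal_inter_add_sdiff₀ (μ := μ) (s := (openConn s c)ᶜ) (t := openConn s a ∪ openConn c a)
      (MeasurableSet.of_discrete).nullMeasurableSet]
    congr 2
  have hDc : μ.real ((openConn s c)ᶜ) =
      1 - (μ.real (openConn s a ∩ openConn s c) + μ.real (openConn s c ∩ (openConn s a)ᶜ)) := by
    rw [measureReal_compl MeasurableSet.of_discrete, probReal_univ]
    congr 1
    conv_lhs => rw [HalvingTransplant.openConn_eq_J_union_SC s a c]
    rw [measureReal_union _ MeasurableSet.of_discrete]
    rw [Set.disjoint_left]
    rintro ω ⟨hsa, -⟩ ⟨-, hna⟩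
    exact hna hsa
  set X := μ.real ((openConn s a ∪ openConn c a) ∩ (openConn s c)ᶜ)
  set T := μ.real (openConn s a ∩ openConn s c)
  set P0 := μ.real ((openConn s a)ᶜ ∩ (openConn s c)ᶜ ∩ (openConn c a)ᶜ)
  set P3 := μ.real (openConn s c ∩ (openConn s a)ᶜ)
  set P1 := μ.real (openConn s a ∩ (openConn s c)ᶜ)
  set P2 := μ.real (openConn c a ∩ (openConn c s)ᶜ)
  have h1 : 0 ≤ P1 := measureReal_nonneg
  have hp2 : P2 ≤ 1 := measureReal_le_one
  have hp3 : P3 ≤ 1 := measureReal_le_one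
  rw [hU, hD] at hP
  have hD' : X + P0 = 1 - (T + P3) := by rw [← hD, hDc]
  have hsum : T + P1 + P2 + P3 + P0 = 1 := by linarith
  have hP' : (T + P1 + P2) * (P0 + P1 + P2) - (P1 + P2) ≤ Real.sqrt (P1 * P2) := by
    have e1 : (X + T) * (X + P0) - X = (T + P1 + P2) * (P0 + P1 + P2) - (P1 + P2) := by rw [hX]; ring
    linarith [e1]
  have hc := conj101_of_productForm h1 hp2 hp3 hsum hP'
  exact ⟨by linarith [core_of_productForm hsum hP'], by linarith [hc.2]⟩

/-- **Product form ⟹ sharp halving, measure form**: `2·μ(U)·μ(D) ≤ 3·μ(U ∩ D)` at every `(w; s, a, c)` satisfying the product form. [this work] -/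
theorem sharp_halving_of_productForm_real (w : Sym2 V → unitInterval) (s a c : V)
    (hP : (prodBernoulli w).real (openConn s a ∪ openConn c a) * (prodBernoulli w).real ((openConn s c)ᶜ) -
        (prodBernoulli w).real ((openConn s a ∪ openConn c a) ∩ (openConn s c)ᶜ) ≤
      Real.sqrt ((prodBernoulli w).real (openConn s a ∩ (openConn s c)ᶜ) * (prodBernoulli w).real (openConn c a ∩ (openConn c s)ᶜ))) :
    2 * ((prodBernoulli w).real (openConn s a ∪ openConn c a) * (prodBernoulli w).real ((openConn s c)ᶜ)) ≤
      3 * (prodBernoulli w).real ((openConn s a ∪ openConn c a) ∩ (openConn s c)ᶜ) := by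
  have hX : (prodBernoulli w).real ((openConn s a ∪ openConn c a) ∩ (openConn s c)ᶜ) =
      (prodBernoulli w).real (openConn s a ∩ (openConn s c)ᶜ) + (prodBernoulli w).real (openConn c a ∩ (openConn c s)ᶜ) := by
    rw [HalvingTransplant.inter_D_eq_union, measureReal_union (HalvingTransplant.disjoint_pairSep s a c) MeasurableSet.of_discrete]
  exact sharp_halving_of_productForm measureReal_nonneg measureReal_nonneg hX hP

/-- **Product form ⟹ the quadratic-rate dichotomy, measure form**: `μ(sa|c), μ(ac|s) < ε²/3 ⟹ μ(sac) < ε ∨ μ(s|a|c) < ε`.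
[cite: Gladkov2024, Thm. 1.3] [this work] -/
theorem dichotomy_of_productForm_real (w : Sym2 V → unitInterval) (s a c : V) {ε : ℝ} (hε : 0 < ε)
    (hP : (prodBernoulli w).real (openConn s a ∪ openConn c a) * (prodBernoulli w).real ((openConn s c)ᶜ) -
        (prodBernoulli w).real ((openConn s a ∪ openConn c a) ∩ (openConn s c)ᶜ) ≤
      Real.sqrt ((prodBernoulli w).real (openConn s a ∩ (openConn s c)ᶜ) * (prodBernoulli w).real (openConn c a ∩ (openConn c s)ᶜ)))
    (h1 : (prodBernoulli w).real (openConn s a ∩ (openConn s c)ᶜ) < ε ^ 2 / 3)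
    (h2 : (prodBernoulli w).real (openConn c a ∩ (openConn c s)ᶜ) < ε ^ 2 / 3) :
    (prodBernoulli w).real (openConn s a ∩ openConn s c) < ε ∨
      (prodBernoulli w).real ((openConn s a)ᶜ ∩ (openConn s c)ᶜ ∩ (openConn c a)ᶜ) < ε := by
  have h := (productForm_cells w s a c hP).1
  set μ := prodBernoulli w
  by_contra hcon
  rw [not_or, not_lt, not_lt] at hcon
  obtain ⟨hT, hP0⟩ := hcon
  have hεε : ε * ε ≤ μ.real (openConn s a ∩ openConn s c) * μ.real ((openConn s a)ᶜ ∩ (openConn s c)ᶜ ∩ (openConn c a)ᶜ) :=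
    mul_le_mul hT hP0 hε.le measureReal_nonneg
  have hs : ∀ {p₁ p₂ : ℝ}, 0 ≤ p₁ → 0 ≤ p₂ → Real.sqrt (p₁ * p₂) ≤ (p₁ + p₂) / 2 := by
    intro p₁ p₂ h1 h2
    have h : p₁ * p₂ ≤ ((p₁ + p₂) / 2) ^ 2 := by nlinarith [sq_nonneg (p₁ - p₂)]
    calc Real.sqrt (p₁ * p₂) ≤ Real.sqrt (((p₁ + p₂) / 2) ^ 2) := Real.sqrt_le_sqrt h
      _ = (p₁ + p₂) / 2 := Real.sqrt_sq (by linarith)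
  have hs := hs (p₁ := μ.real (openConn s a ∩ (openConn s c)ᶜ)) (p₂ := μ.real (openConn c a ∩ (openConn c s)ᶜ))
    measureReal_nonneg measureReal_nonneg
  have hp3 : μ.real (openConn s c ∩ (openConn s a)ᶜ) ≤ 1 := measureReal_le_one
  have hq1 : 0 ≤ μ.real (openConn s a ∩ (openConn s c)ᶜ) := measureReal_nonneg
  have hq2 : 0 ≤ μ.real (openConn c a ∩ (openConn c s)ᶜ) := measureReal_nonneg
  nlinarith [h, hs, hp3, hεε, hq1, hq2, sq_nonneg ε]

end ProductForm

end Summit.CriticalPhenomena.PercolationContinuityZ3.Theorems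

end
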